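import Literature.NumberTheory.LFunctions.ConreyIwaniec2002CircleMethodDefs
import Literature.NumberTheory.QuadraticFields.GenusCharacterFactorization
import Literature.NumberTheory.EllipticCurves.HeegnerPointsImaginaryQuadraticProofs
import Literature.Barriers.Parity.SiegelZeroPrimePairsProofs
import Mathlib.Data.Nat.Squarefree
import HarnessLib

/-!
# Conrey–Iwaniec (2002), §2 (2.19): the genus characters of `Cl(K)` BY VALUES — existence for every divisor `s ∣ q`, uniqueness, reality

B. Conrey, H. Iwaniec, *Spacing of zeros of Hecke `L`-functions and the class number problem*,
Acta Arith. 103 (2002) 259–312 [held text `paper:arxiv-math_0111012`, chunk p0006 (2.19)–(2.20)]: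
«Any real character `ψ ∈ Ĉl(K)` is given uniquely by `ψ(𝔭) = χ_v(N𝔭)` if `p ∤ v`, `χ_w(N𝔭)` if
`p ∤ w`, where `χ_vχ_w = χ_q` … they are called the genus characters.»

The `ls-inputs` line `theta-circle-method` / sub-line `theta-voronoi` (SKELETONS S3, S3d) speaks of
"`ψ` is the genus character attached to the divisor `D`" through the predicate
`ConreyIwaniec2002.IsGenusCharFor ψ D` (`ConreyIwaniec2002CircleMethodDefs.lean`, p644031), stated
BY VALUES: `ψ([𝔭]) = (N𝔭/D)` for every prime `𝔭` of norm prime to `D`.  The registered stub V1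
`stub_theta_omega` asks, for EVERY `c ≥ 1`, for a character `ψ'` with
`IsGenusCharFor (ψ'ψ⁻¹) (c,q)` — i.e. for the genus character `ψ_s` of every divisor `s = (c,q)`
of `q` as an element of `Ĉl(K)`.  This file PROVES (theorems only, no definitions, no named facts)
that API over the tree's genus theory (`Quadratic.genusCharProd`, Cox §3.B Thm. 3.15; small
unfolding helpers are `private`):

* `exists_isGenusCharFor` — **existence**: for `q` odd carrying a primitive quadratic character
  (so `q` is squarefree), `K` quadratic with `d_K = −q`, and every `s ∣ q`, there is
  `ψ_s ∈ Ĉl(K)` with `IsGenusCharFor ψ_s s` and `ψ_s² = 1`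
  (`ψ_s = Quadratic.genusCharProd hK (primeFactors s)`, values `(N𝔭/∏_{p∣s} p) = (N𝔭/s)` by
  `Quadratic.genusCharProd_mk0_eq` and `∏_{p ∣ s} p = s`);
* `eq_of_isGenusCharFor` — **uniqueness given the modulus** (`D ≠ 0`): two characters with the
  genus values of `D` coincide (a class group character is determined by its values on the
  primes of norm prime to `D`, tree `Quadratic.classGroupChar_eq_one_of_primeValue`,
  Neukirch VI (1.9); the values `(N𝔭/D) = ±1` there);
* `mul_self_eq_one_of_isGenusCharFor` — **reality**: such a `ψ` has `ψ² = 1`;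
* `isGenusCharFor_one_iff` — `D = 1` gives exactly `ψ = 1`;
* `exists_isGenusCharFor_mul_inv` — the V1-shaped corollary: for every `ψ` and `c`,
  `∃ ψ', IsGenusCharFor (ψ'ψ⁻¹) (c,q)` (`ψ' = ψ_{(c,q)}·ψ`).

Not here (other seats): the classification of the moduli (`IsGenusCharFor ψ s ∧ IsGenusCharFor ψ s'
⇒ s' ∈ {s, q/s}`), the complement `s ↔ q/s`, and "real `ψ` ⇒ genus" (`Quadratic.exists_genusCharProd_eq`).
Nothing here proves anything about `L`-functions. «The programme SEARCHES and TYPES; no claim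
about Landau–Siegel zeros, Theorems 1–2 of arXiv:2211.02515 or a repaired Margin232 until a kernel
theorem says so.»

## References

* [ConreyIwaniec2002] B. Conrey, H. Iwaniec, Acta Arith. 103 (2002) 259–312, arXiv:math/0111012:
  §2 (2.19)–(2.20).
* [Cox2013] D. A. Cox, *Primes of the form x² + ny²*, 2nd ed. (2013), §3.B Thm. 3.15.
* [NeukirchANT1999] J. Neukirch, *Algebraic Number Theory* (1999), Ch. VI §1 (1.9).
-/

noncomputable section

open scoped NumberField

namespace Literature.NumberTheory.LFunctions

namespace ConreyIwaniec2002

open NumberField Literature.NumberTheory.LFunctions.NumberField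
open Literature.NumberTheory.QuadraticFields Literature.NumberTheory.EllipticCurves
open IsDedekindDomain

section Values

variable {K : Type*} [Field K] [NumberField K]

/-- `ψ_{χ₁χ₂}(𝔭) = ψ_{χ₁}(𝔭)·ψ_{χ₂}(𝔭)`. [folklore] -/
private theorem classGroupCharPrimeValue_mul (χ₁ χ₂ : ClassGroup (𝓞 K) →* ℂˣ)
    (v : HeightOneSpectrum (𝓞 K)) :
    classGroupCharPrimeValue (χ₁ * χ₂) v =
      classGroupCharPrimeValue χ₁ v * classGroupCharPrimeValue χ₂ v := by
  simp only [classGroupCharPrimeValue_apply, MonoidHom.mul_apply, Units.val_mul]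

/-- `ψ_1(𝔭) = 1`. [folklore] -/
private theorem classGroupCharPrimeValue_one (v : HeightOneSpectrum (𝓞 K)) :
    classGroupCharPrimeValue (1 : ClassGroup (𝓞 K) →* ℂˣ) v = 1 := by
  simp only [classGroupCharPrimeValue_apply, MonoidHom.one_apply, Units.val_one]

/-- `ψ_{χ⁻¹}(𝔭) = ψ_χ(𝔭)⁻¹`. [folklore] -/
private theorem classGroupCharPrimeValue_inv (χ : ClassGroup (𝓞 K) →* ℂˣ)
    (v : HeightOneSpectrum (𝓞 K)) :
    classGroupCharPrimeValue χ⁻¹ v = (classGroupCharPrimeValue χ v)⁻¹ := by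
  simp only [classGroupCharPrimeValue_apply, MonoidHom.inv_apply, Units.val_inv_eq_inv_val]

/-- The Jacobi symbol `(a/D)` at `(a, D) = 1` is `±1`: as a complex number its square is `1`.
[folklore] -/
private theorem jacobiSym_mul_self_of_coprime {a D : ℕ} (h : a.Coprime D) :
    (jacobiSym a D : ℂ) * (jacobiSym a D : ℂ) = 1 := by
  have hg : (a : ℤ).gcd D = 1 := by rw [Int.gcd_natCast_natCast]; exact h
  rcases jacobiSym.eq_one_or_neg_one hg with h1 | h1 <;> simp [h1]

/-- The Jacobi symbol `(a/D)` at `(a, D) = 1` is non-zero in `ℂ`. [folklore] -/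
private theorem jacobiSym_cast_ne_zero_of_coprime {a D : ℕ} (h : a.Coprime D) :
    (jacobiSym a D : ℂ) ≠ 0 := fun h0 ↦ by
  have := jacobiSym_mul_self_of_coprime h
  rw [h0, mul_zero] at this
  exact zero_ne_one this

/-- **`D = 1`: the genus character of the trivial divisor is the trivial character** (every norm is
prime to `1` and `(n/1) = 1`; a character with all prime values `1` is trivial,
`Quadratic.classGroupChar_eq_one_of_primeValue`). [cite: ConreyIwaniec2002, §2 (2.19)–(2.20)]
[cite: NeukirchANT1999, Ch. VI §1 (1.9)] -/
theorem isGenusCharFor_one_iff (ψ : ClassGroup (𝓞 K) →* ℂˣ) : IsGenusCharFor ψ 1 ↔ ψ = 1 := by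
  constructor
  · intro h
    refine Quadratic.classGroupChar_eq_one_of_primeValue one_ne_zero ψ fun v hv ↦ ?_
    rw [h v hv, jacobiSym.one_right, Int.cast_one]
  · rintro rfl v -
    rw [classGroupCharPrimeValue_one, jacobiSym.one_right, Int.cast_one]

/-- **Uniqueness of the genus character of a given divisor `D ≠ 0`** ((2.19) «is given uniquely
by»): if `ψ` and `ψ'` both have the values `(N𝔭/D)` on the primes of norm prime to `D`, then
`ψ = ψ'` — `ψ'ψ⁻¹` has the value `(N𝔭/D)(N𝔭/D)⁻¹ = 1` there, hence is trivial
(`Quadratic.classGroupChar_eq_one_of_primeValue`). [cite: ConreyIwaniec2002, §2 (2.19)]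
[cite: NeukirchANT1999, Ch. VI §1 (1.9)] -/
theorem eq_of_isGenusCharFor {D : ℕ} (hD : D ≠ 0) {ψ ψ' : ClassGroup (𝓞 K) →* ℂˣ}
    (h : IsGenusCharFor ψ D) (h' : IsGenusCharFor ψ' D) : ψ = ψ' := by
  have key : ψ' * ψ⁻¹ = 1 := by
    refine Quadratic.classGroupChar_eq_one_of_primeValue hD _ fun v hv ↦ ?_
    rw [classGroupCharPrimeValue_mul, classGroupCharPrimeValue_inv, h v hv, h' v hv]
    exact mul_inv_cancel₀ (jacobiSym_cast_ne_zero_of_coprime hv)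
  exact (mul_inv_eq_one.mp key).symm

/-- **Genus characters are real**: if `ψ` has the genus values of `D ≠ 0`, then `ψ² = 1`
(`ψ²` has prime values `(N𝔭/D)² = 1` off `D`). [cite: ConreyIwaniec2002, §2 (2.19)]
[cite: NeukirchANT1999, Ch. VI §1 (1.9)] -/
theorem mul_self_eq_one_of_isGenusCharFor {D : ℕ} (hD : D ≠ 0) {ψ : ClassGroup (𝓞 K) →* ℂˣ}
    (h : IsGenusCharFor ψ D) : ψ * ψ = 1 := by
  refine Quadratic.classGroupChar_eq_one_of_primeValue hD _ fun v hv ↦ ?_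
  rw [classGroupCharPrimeValue_mul, h v hv]
  exact jacobiSym_mul_self_of_coprime hv

end Values

section Existence

/-- `q` odd carrying a primitive quadratic character is squarefree (no odd `p² ∣ q`, tree
`SiegelCorr.not_odd_prime_sq_dvd`; `4 ∤ q` as `q` is odd). [folklore] -/
private theorem squarefree_of_odd_of_isPrimitive_isQuadratic {q : ℕ} [NeZero q] (hodd : Odd q)
    (χ : DirichletCharacter ℂ q) (hprim : χ.IsPrimitive) (hquad : χ.IsQuadratic) :
    Squarefree q := by
  rw [Nat.squarefree_iff_prime_squarefree]
  intro p hp hpp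
  have hp2 : p ≠ 2 := by
    rintro rfl
    exact (Nat.not_even_iff_odd.mpr hodd) (even_iff_two_dvd.mpr ((dvd_mul_right 2 2).trans hpp))
  exact Literature.Barriers.Parity.SiegelCorr.not_odd_prime_sq_dvd χ hprim hquad hp hp2
    (by rw [pow_two]; exact hpp)

/-- **Existence of the genus character of every divisor `s ∣ q`, by values** ((2.19): `ψ_v(𝔭) =
χ_v(N𝔭)` for `p ∤ v`): for `q` odd carrying a primitive quadratic character `χ` (so `q` is
squarefree), `K` quadratic with `d_K = −q`, and `s ∣ q`, there is `ψ_s ∈ Ĉl(K)` with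
`ψ_s([𝔭]) = (N𝔭/s)` for every prime `𝔭` of norm prime to `s`, and `ψ_s² = 1`.  It is the tree's
product of prime genus characters `Quadratic.genusCharProd hK (primeFactors s)` (Cox Thm. 3.15),
whose values are `(N𝔭/∏_{p∣s}p)` (`Quadratic.genusCharProd_mk0_eq`), and `∏_{p∣s}p = s`.
[cite: ConreyIwaniec2002, §2 (2.19)] [cite: Cox2013, §3.B Thm. 3.15] -/
theorem exists_isGenusCharFor (q : ℕ) [NeZero q] (hodd : Odd q) (χ : DirichletCharacter ℂ q)
    (hprim : χ.IsPrimitive) (hquad : χ.IsQuadratic) (K : Type*) [Field K] [NumberField K]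
    (h2 : Module.finrank ℚ K = 2) (hdisc : NumberField.discr K = -(q : ℤ)) {s : ℕ} (hs : s ∣ q) :
    ∃ ψs : ClassGroup (𝓞 K) →* ℂˣ, IsGenusCharFor ψs s ∧ ψs * ψs = 1 := by
  classical
  have hq0 : 0 < q := Nat.pos_of_ne_zero (NeZero.ne q)
  have hK : IsImaginaryQuadratic K :=
    isImaginaryQuadratic_iff_discr_neg.2 ⟨h2, by rw [hdisc]; omega⟩
  have hsqf : Squarefree q := squarefree_of_odd_of_isPrimitive_isQuadratic hodd χ hprim hquad
  have hssq : Squarefree s := hsqf.squarefree_of_dvd hs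
  have hS : ∀ p ∈ s.primeFactors, p.Prime ∧ p ≠ 2 ∧ (p : ℤ) ∣ NumberField.discr K := by
    intro p hp
    have hpp : p.Prime := Nat.prime_of_mem_primeFactors hp
    have hps : p ∣ s := Nat.dvd_of_mem_primeFactors hp
    refine ⟨hpp, ?_, ?_⟩
    · rintro rfl
      exact (Nat.not_even_iff_odd.mpr hodd) (even_iff_two_dvd.mpr (hps.trans hs))
    · rw [hdisc]
      exact (dvd_neg).mpr (Int.natCast_dvd_natCast.mpr (hps.trans hs))
  refine ⟨Quadratic.genusCharProd hK s.primeFactors hS, ?_, Quadratic.genusCharProd_mul_self⟩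
  have hmod : Quadratic.genusModulus s.primeFactors = s :=
    Nat.prod_primeFactors_of_squarefree hssq
  intro v hv
  have hcop : ∀ p ∈ s.primeFactors, ¬ (p : ℤ) ∣ Ideal.absNorm v.asIdeal := by
    intro p hp hdvd
    have hpp : p.Prime := Nat.prime_of_mem_primeFactors hp
    have hps : p ∣ s := Nat.dvd_of_mem_primeFactors hp
    have h1 : p ∣ Nat.gcd (Ideal.absNorm v.asIdeal) s :=
      Nat.dvd_gcd (Int.natCast_dvd_natCast.mp hdvd) hps
    rw [hv] at h1
    exact hpp.ne_one (Nat.dvd_one.mp h1)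
  rw [classGroupCharPrimeValue_apply,
    Quadratic.genusCharProd_mk0_eq (mem_nonZeroDivisors_of_ne_zero v.ne_bot) hcop, hmod]

/-- **The opening move of V1 `stub_theta_omega`**: for every `ψ ∈ Ĉl(K)` and every `c`, there is
`ψ' ∈ Ĉl(K)` with `ψ'ψ⁻¹` the genus character of `s = (c,q)` — namely `ψ' = ψ_s·ψ`
(`exists_isGenusCharFor` with `s = (c,q) ∣ q`). [cite: ConreyIwaniec2002, §2 (2.19); §3 (3.16)–(3.18)] -/
theorem exists_isGenusCharFor_mul_inv (q : ℕ) [NeZero q] (hodd : Odd q)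
    (χ : DirichletCharacter ℂ q) (hprim : χ.IsPrimitive) (hquad : χ.IsQuadratic)
    (K : Type*) [Field K] [NumberField K] (h2 : Module.finrank ℚ K = 2)
    (hdisc : NumberField.discr K = -(q : ℤ)) (ψ : ClassGroup (𝓞 K) →* ℂˣ) (c : ℕ) :
    ∃ ψ' : ClassGroup (𝓞 K) →* ℂˣ,
      IsGenusCharFor (ψ' * ψ⁻¹) (Nat.gcd c q) ∧ (ψ' * ψ⁻¹) * (ψ' * ψ⁻¹) = 1 := by
  obtain ⟨ψs, hψs, hreal⟩ :=
    exists_isGenusCharFor q hodd χ hprim hquad K h2 hdisc (Nat.gcd_dvd_right c q)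
  have hcancel : ψs * ψ * ψ⁻¹ = ψs :=
    MonoidHom.ext fun A ↦ by simp only [MonoidHom.mul_apply, MonoidHom.inv_apply, mul_inv_cancel_right]
  refine ⟨ψs * ψ, ?_, ?_⟩ <;> rw [hcancel]
  · exact hψs
  · exact hreal

end Existence

end ConreyIwaniec2002

end Literature.NumberTheory.LFunctions

end
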